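import Summits.MatrixMultiplication.OmegaCensus.LocalUSPOmegaBound
import Literature.Computability.AlgebraicComplexity.StrongUSP
import HarnessLib

/-!
# ω-census, family (b′) STPP / USP: the ω-bound of an arbitrary STRONG USP (CKSU Cor. 3.6 = AJX Lemma 1) as a theorem

HONEST FRAMING (pub-omega census; verbatim): lottery ticket; floor = certified bounds/negative ranges.
Census BOOKKEEPING for the Cohn–Umans STPP / USP track (`pub-omega-stpp-*`), not progress on `ω`: the tree proves
`ω < 2.373` by the laser method (`LeGall2014_cw4`); every bound derivable from a strong USP of width `k ≤ 12` in print is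
`≥ 2.65` (Anderson–Ji–Xu 2020 Table 1), and the strong-USP method as a whole is capped at `2.48…`-type values by the
strong USP capacity (CKSU §3) — see `pub-omega-stpp-3/BARRIERS.md`.

## Content

`LocalUSPOmegaBound.lean` proves, for a LOCAL strong USP of `s` rows and width `k` and any `m ≥ 3`,
`ω ≤ 3 (k log m − log s) / (k log (m − 1))` (`omega_le_of_isLocalStrongUSP`; CKSU Thm. 33 + Thm. 5.5, both tree-proved).
Cohn–Kleinberg–Szegedy–Umans 2005, Proposition 6.3 / 34 — now PROVED in
`Literature/Computability/AlgebraicComplexity/StrongUSP.lean` (`IsStrongUSP.exists_isLocalStrongUSP`) — turns any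
strong USP of `s` rows and width `k` into a local strong USP of `s!` rows and width `s·k`; substituting gives
EXACTLY the printed Corollary 3.6 / 16 of CKSU 2005 (= Anderson–Ji–Xu 2020, Lemma 1):

  `ω ≤ 3 (s k log m − log s!) / (s k log (m − 1)) = 3 log m / log(m−1) − 3 log(s!)/(s k log(m−1))`   (`omega_le_of_isStrongUSP`),

for every strong USP (`IsStrongUSP`, CKSU §3 definition verbatim) and every `m ≥ 3`; and the decimal form
`m^{3 b s k} ≤ (s!)^{3b} (m−1)^{a s k} ⇒ ω ≤ a/b` (`omega_le_div_of_isStrongUSP`), so a census row for an explicit strong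
USP is: `decide` the strong-USP property (feasible by brute force only for `s ≤ 4` or so — `(s!)²` permutation pairs after
`isStrongUSP_iff_fix_first`; larger puzzles need a verified backtracking checker, not in the tree yet) + `decide +kernel` one
integer inequality.  ONE instance is included as the end-to-end kernel check of the chain: the `(3,3)` strong USP
`{111, 123, 233}` (a maximum-size strong USP of width 3: Anderson–Ji–Xu 2020 Table 1, `k = 3`, "3 = s", ω column `2.85`
(arXiv v1, 2 dp) / `2.849` (SAT'20, 3 dp, nearest-rounded; the exact value is `2.8494201…` at `m = 20`)) certifies
`ω ≤ 2.8495` in the kernel.  It is NOT a local strong USP (no strong USP of sizes `(2,2)` or `(3,3)` is local — brute force,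
`pub-omega-lit-g12` seat folder `susp/local_check.py`), so this row genuinely goes through Proposition 34.
-/

noncomputable section

open Literature.Computability.AlgebraicComplexity

namespace Summit.MatrixMultiplication.OmegaCensus

/-- **CKSU 2005 Corollary 3.6 / 16 (= Anderson–Ji–Xu 2020, Lemma 1) as a theorem**: a strong USP of `s ≥ 1` rows and
width `k ≥ 1` gives, for every modulus `m ≥ 3`, `ω ≤ 3 (s k log m − log s!) / (s k log (m − 1))`.  Proof: CKSU Prop. 34
(`IsStrongUSP.exists_isLocalStrongUSP`: a local strong USP of `s!` rows and width `s k`) fed to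
`omega_le_of_isLocalStrongUSP` (CKSU Thm. 33 + Thm. 5.5).
[cite: CohnKleinbergSzegedyUmans2005, Corollary 16 (§3) and Proposition 34 (§6.1)] -/
theorem omega_le_of_isStrongUSP {s k : ℕ} {row : Fin s → Fin k → Fin 3}
    (hU : IsStrongUSP row) (hs : 0 < s) (hk : 0 < k) {m : ℕ} (hm : 3 ≤ m) :
    omega ℂ ≤ 3 * (((s * k : ℕ) : ℝ) * Real.log m - Real.log (Nat.factorial s : ℕ)) /
      (((s * k : ℕ) : ℝ) * Real.log ((m : ℝ) - 1)) := by
  obtain ⟨row', h'⟩ := hU.exists_isLocalStrongUSP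
  exact omega_le_of_isLocalStrongUSP h' (Nat.factorial_pos s) (Nat.mul_pos hs hk) hm

/-- **Decimal consequences are integer inequalities** (strong-USP version of `omega_le_div_of_isLocalStrongUSP`): with a
strong USP of `s ≥ 1` rows and width `k ≥ 1`, `m ≥ 3` and naturals `a`, `b ≥ 1`, if `m^{3 b (s k)} ≤ (s!)^{3b} · (m−1)^{a (s k)}`
then `ω ≤ a / b`. [cite: CohnKleinbergSzegedyUmans2005, Corollary 16 (§3) and Proposition 34 (§6.1)] -/
theorem omega_le_div_of_isStrongUSP {s k : ℕ} {row : Fin s → Fin k → Fin 3}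
    (hU : IsStrongUSP row) (hs : 0 < s) (hk : 0 < k) {m : ℕ} (hm : 3 ≤ m) {a b : ℕ} (hb : 0 < b)
    (h : m ^ (3 * b * (s * k)) ≤ (Nat.factorial s) ^ (3 * b) * (m - 1) ^ (a * (s * k))) :
    omega ℂ ≤ (a : ℝ) / (b : ℝ) := by
  obtain ⟨row', h'⟩ := hU.exists_isLocalStrongUSP
  exact omega_le_div_of_isLocalStrongUSP h' (Nat.factorial_pos s) (Nat.mul_pos hs hk) hm hb h

/-- Census row (b′), END-TO-END KERNEL CHECK OF THE STRONG-USP CHAIN: the strong USP `{111, 123, 233}` (3 rows, width 3;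
a maximum-size strong USP of width 3 — Anderson–Ji–Xu 2020, Table 1: `k = 3`, "3 = s", ω `2.849` (SAT'20) / `2.85`
(arXiv:2301.00074v1); NOT a local strong USP) with modulus `m = 20` certifies `ω ≤ 2.8495 = 28495/10000`
(integer certificate `20^{270000} ≤ 6^{30000} · 19^{256455}`; exact value of the row `3(9 log 20 − log 6)/(9 log 19) = 2.8494201…`;
the printed 3-dp `2.849` is the nearest rounding, not an upper bound: `20^{27000} > 6^{3000} · 19^{25641}`).
[cite: AndersonJiXu2020, Table 1 (k = 3)] [cite: CohnKleinbergSzegedyUmans2005, Corollary 16 and Proposition 34] -/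
theorem omega_le_of_strongUSP_3_3 : omega ℂ ≤ 2.8495 := by
  have h := omega_le_div_of_isStrongUSP (row := ![![0, 0, 0], ![0, 1, 2], ![1, 2, 2]])
    (by rw [isStrongUSP_iff_fix_first]; decide) (by norm_num) (by norm_num)
    (m := 20) (by norm_num) (a := 28495) (b := 10000) (by norm_num) (by decide +kernel)
  have e : ((28495 : ℕ) : ℝ) / ((10000 : ℕ) : ℝ) = 2.8495 := by norm_num
  rwa [e] at h

/-- Census row (b′): the strong USP `{1111, 1123, 1233, 2313, 2332}` (5 rows, width 4; a MAXIMUM-size strong USP of width 4 —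
Anderson–Ji–Xu 2020, Table 1: `k = 4`, "5 = s" (exhaustive), ω `2.806` (SAT'20, nearest-rounded) / `2.81` (arXiv v1); this
representative = the first of the 190 `S₃ × S₄`-classes of (5,4) strong USPs listed by `pub-omega-stpp-1` kit j155983,
`k4_strong.classes_size5.txt`) with modulus `m = 16` certifies `ω ≤ 2.8064 = 7016/2500` (integer certificate
`16^{150000} ≤ 120^{7500} · 15^{140320}`; exact value of the row `3(20 log 16 − log 120)/(20 log 15) = 2.8063151…`; `2.8063` fails:
`16^{600000} > 120^{30000} · 15^{561260}`).  `decide +kernel` on the CKSU definition ((5!)² = 14 400 permutation pairs after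
`isStrongUSP_iff_fix_first`; ≈ 30 s).  The `k = 5` row ((8,5), ω `2.777`) is out of reach of `decide` ((8!)² pairs) and waits for a
verified checker; the `k = 2` row ((2,2) ⇒ `ω ≤ 2.875`) is the already-landed statement `omega_le_of_localSUSP_w4_s2`
(`LocalUSPInstancesClosed.lean`, same decimal). [cite: AndersonJiXu2020, Table 1 (k = 4)] [cite: CohnKleinbergSzegedyUmans2005, Corollary 16 and Proposition 34] -/
theorem omega_le_of_strongUSP_5_4 : omega ℂ ≤ 2.8064 := by
  have h := omega_le_div_of_isStrongUSP
    (row := ![![0, 0, 0, 0], ![0, 0, 1, 2], ![0, 1, 2, 2], ![1, 2, 0, 2], ![1, 2, 2, 1]])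
    (by rw [isStrongUSP_iff_fix_first]; decide +kernel) (by norm_num) (by norm_num)
    (m := 16) (by norm_num) (a := 7016) (b := 2500) (by norm_num) (by decide +kernel)
  have e : ((7016 : ℕ) : ℝ) / ((2500 : ℕ) : ℝ) = 2.8064 := by norm_num
  rwa [e] at h

end Summit.MatrixMultiplication.OmegaCensus

end
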